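import Literature.AlgebraicGeometry.Frobenioids.Monoids
import HarnessLib

/-!
# Frobenioids I, §0: the divisibility order `Order(M)` of a sharp integral monoid has NO Boolean factor

S. Mochizuki, *The geometry of Frobenioids I: the general theory*, Kyushu J. Math. **62** (2008), §0 "Monoids"
(kurims pp. 11–12): sharp and integral monoids, the relation `a ≤ b` ("`b − a ∈ M`", here `a ∣ b`) and the category
/ partially ordered set `Order(M)` it determines (the tree's `DivOrder M`) [cite: MochizukiFrdI2008, §0 p.12].

PROOF-ONLY file (0 definitions), abc-iut cell, seat abc-iut-f-128 (gen 15).  A combinatorial fact about `Order(M)`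
recorded for the census of FACT-LIST row F-2809 (`Cor38Hyp.PreservesPreSteps`, [EtTh] Cor. 3.8 proof row C38-L02a):
the desk reduction of the residual over the walking-arrow base (HOME/staging/f/f-128/g15/F-2809-CENSUS-10-f128g15.md
§2(d)) asks whether the divisibility order of a cancellative divisor monoid `K` can be order-isomorphic to
`{0 < 1} × Order(K)` — the shape a would-be level-mixing self-equivalence of the model Frobenioid over `[1]` must
realise on the predecessor posets of its pre-step subcategories.  THIS FILE ANSWERS NO for sharp, integral (=
cancellative) monoids without `2`-torsion (`a² = b² ⇒ a = b`; every free, `ℕ`-, `ℚ_{≥0}`-, `ℝ_{≥0}`-valued divisor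
monoid of the cell's records):
* **`not_dvd_iso_bool_bool_prod`** — there is no bijection `f : Bool × Bool × M ≃ M` translating the product order
  (`false < true` twice, divisibility on `M`) into divisibility.  (Let `b = f(1,0,0)`; the element `x = f⁻¹(b²)` lies
  above `(1,0,0)` and COVERS it, because a `y` strictly between would give a complementary divisor `b²/f(y)` strictly
  below `b` other than `1`; so `x = (1,1,0)` or `x = (1,0,q)` with `q` an atom, and in both cases the four divisors of
  `b²` leave no room for the complementary divisor of the fourth one without `2`-torsion or a collision.)
* **`not_dvd_iso_bool_prod`** — hence no bijection `Bool × M ≃ M` translating the product order into divisibility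
  (iterate it once).
Nothing here is specific to Frobenioids; no statement of the paper is strengthened; typed ≠ proved.
-/

namespace Literature.AlgebraicGeometry.Frobenioids

universe u

variable {M : Type u} [CommMonoid M]

/-- In a sharp monoid the only divisor of `1` is `1`. [cite: MochizukiFrdI2008, §0 p.11] -/
theorem eq_one_of_dvd_one_of_isSharp (hS : IsSharp M) {a : M} (h : a ∣ 1) : a = 1 :=
  hS.1 a (isUnit_of_dvd_one h)

/-- **`Order(M)` has no factor `{0 < 1}²`**: for a sharp, integral (cancellative) commutative monoid `M` without
`2`-torsion there is no bijection `f : Bool × Bool × M ≃ M` with `f x ∣ f y ↔ x ≤ y` for the product order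
(`false < true` on both Boolean coordinates, divisibility on `M`). [cite: MochizukiFrdI2008, §0 p.12] -/
theorem not_dvd_iso_bool_bool_prod (hS : IsSharp M) [IsCancelMul M] (h2 : ∀ a b : M, a * a = b * b → a = b)
    (f : Bool × Bool × M ≃ M)
    (hf : ∀ x y : Bool × Bool × M, f x ∣ f y ↔ ((x.1 ≤ y.1 ∧ x.2.1 ≤ y.2.1) ∧ x.2.2 ∣ y.2.2)) : False := by
  -- the bottom goes to `1`
  have h0 : f (false, false, 1) = 1 :=
    eq_one_of_dvd_one_of_isSharp hS (by
      have := (hf (false, false, 1) (f.symm 1)).2 ⟨⟨Bool.false_le _, Bool.false_le _⟩, one_dvd _⟩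
      rwa [f.apply_symm_apply] at this)
  set b : M := f (true, false, 1) with hb
  have hb1 : b ≠ 1 := fun h => by
    have := f.injective (h.trans h0.symm)
    simp at this
  -- `x := f⁻¹ (b²) = (x1, x2, q)` lies above `(true, false, 1)`, so `x1 = true`
  obtain ⟨⟨x1, x2, q⟩, hfx⟩ : ∃ x : Bool × Bool × M, f x = b * b := ⟨f.symm (b * b), f.apply_symm_apply _⟩
  have htx : ((true ≤ x1 ∧ false ≤ x2) ∧ (1 : M) ∣ q) :=
    (hf (true, false, 1) (x1, x2, q)).1 (by rw [hfx]; exact Dvd.intro b rfl)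
  have hx1 : x1 = true := by
    have := htx.1.1
    revert this; cases x1 <;> simp
  subst hx1
  -- `x ≠ (true,false,1)`
  have hxne : ((true, x2, q) : Bool × Bool × M) ≠ (true, false, 1) := fun h => by
    have : b * b = b := by rw [← hfx, h]
    exact hb1 (mul_left_cancel (a := b) (by rw [this, mul_one]))
  -- KEY: every `y` with `(true,false,1) ≤ y ≤ x` is `(true,false,1)` or `x`
  have hcover : ∀ y : Bool × Bool × M, ((true ≤ y.1 ∧ false ≤ y.2.1) ∧ (1 : M) ∣ y.2.2) →
      ((y.1 ≤ true ∧ y.2.1 ≤ x2) ∧ y.2.2 ∣ q) → y = (true, false, 1) ∨ y = (true, x2, q) := by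
    intro y hy₁ hy₂
    have hby : b ∣ f y := (hf (true, false, 1) y).2 hy₁
    have hyx : f y ∣ b * b := by rw [← hfx]; exact (hf y (true, x2, q)).2 hy₂
    obtain ⟨s, hs⟩ := hby
    obtain ⟨r, hr⟩ := hyx
    -- `b * b = b * s * r`, so `b = s * r` and `r ∣ b`
    have hbsr : b = s * r := mul_left_cancel (a := b) (by rw [hr, hs, mul_assoc])
    have hrb : r ∣ b := ⟨s, by rw [hbsr, mul_comm]⟩
    -- `r = f z` with `z ≤ (true,false,1)`, i.e. `z ∈ {⊥, (true,false,1)}`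
    have hz := (hf (f.symm r) (true, false, 1)).1 (by rw [f.apply_symm_apply]; exact hrb)
    have hz3 : (f.symm r).2.2 = 1 := eq_one_of_dvd_one_of_isSharp hS hz.2
    have hz2 : (f.symm r).2.1 = false := by
      have := hz.1.2; revert this; cases (f.symm r).2.1 <;> simp
    rcases Bool.eq_false_or_eq_true (f.symm r).1 with hz1 | hz1
    · -- `z = (true,false,1)`: `r = b`, so `f y = b`, `y = (true,false,1)`
      left
      have hzr : f.symm r = (true, false, 1) := Prod.ext hz1 (Prod.ext hz2 hz3)
      have hrb' : r = b := by rw [← f.apply_symm_apply r, hzr]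
      rw [hrb'] at hr
      -- `hr : b * b = f y * b`
      have hfy : f y = b := (mul_right_cancel (b := b) hr.symm)
      exact f.injective (hfy.trans hb)
    · -- `z = ⊥`: `r = 1`, so `f y = b²`, `y = x`
      right
      have hzr : f.symm r = (false, false, 1) := Prod.ext hz1 (Prod.ext hz2 hz3)
      have hr1 : r = 1 := by rw [← f.apply_symm_apply r, hzr, h0]
      rw [hr1, mul_one] at hr
      exact f.injective (hr.symm.trans hfx.symm)
  -- complementary divisors inside `↓x`: for `y ≤ x`, `b² / f y = f y'` with `y' ≤ x`
  have hcompl : ∀ y : Bool × Bool × M, ((y.1 ≤ true ∧ y.2.1 ≤ x2) ∧ y.2.2 ∣ q) →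
      ∃ y' : Bool × Bool × M, ((y'.1 ≤ true ∧ y'.2.1 ≤ x2) ∧ y'.2.2 ∣ q) ∧ f y * f y' = b * b := by
    intro y hy
    obtain ⟨r, hr⟩ : f y ∣ b * b := by rw [← hfx]; exact (hf y (true, x2, q)).2 hy
    refine ⟨f.symm r, (hf (f.symm r) (true, x2, q)).1 ?_, by rw [f.apply_symm_apply, hr]⟩
    rw [f.apply_symm_apply, hfx]
    exact ⟨f y, by rw [hr, mul_comm]⟩
  cases x2
  · -- `x = (true, false, q)`, `q ≠ 1` an atom
    have hq1 : q ≠ 1 := fun h => hxne (by rw [h])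
    have hatom : ∀ d : M, d ∣ q → d = 1 ∨ d = q := by
      intro d hd
      rcases hcover (true, false, d) ⟨⟨le_rfl, le_rfl⟩, one_dvd d⟩ ⟨⟨le_rfl, le_rfl⟩, hd⟩ with h | h
      · left; simpa using h
      · right; simpa using h
    -- `c := f (false,false,q)` and its complementary divisor
    obtain ⟨y', hy', hcy'⟩ := hcompl (false, false, q) ⟨⟨Bool.false_le _, le_rfl⟩, dvd_rfl⟩
    have hy'2 : y'.2.1 = false := by
      have := hy'.1.2; revert this; cases y'.2.1 <;> simp
    have hcne1 : f (false, false, q) ≠ 1 := fun h => by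
      have := f.injective (h.trans h0.symm); simp [hq1] at this
    have hcneb : f (false, false, q) ≠ b := fun h => by
      have := f.injective (h.trans hb); simp at this
    have hcnebb : f (false, false, q) ≠ b * b := fun h => by
      have := f.injective (h.trans hfx.symm); simp at this
    rcases hatom y'.2.2 hy'.2 with hd | hd <;> rcases Bool.eq_false_or_eq_true y'.1 with h1 | h1
    · -- y' = (true,false,1): f y' = b ⇒ c * b = b * b ⇒ c = b
      have : y' = (true, false, 1) := Prod.ext h1 (Prod.ext hy'2 hd)
      rw [this, ← hb] at hcy'
      exact hcneb (mul_right_cancel hcy')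
    · -- y' = ⊥: c = b²
      have : y' = (false, false, 1) := Prod.ext h1 (Prod.ext hy'2 hd)
      rw [this, h0, mul_one] at hcy'
      exact hcnebb hcy'
    · -- y' = x: c * b² = b² ⇒ c = 1
      have : y' = (true, false, q) := Prod.ext h1 (Prod.ext hy'2 hd)
      rw [this, hfx] at hcy'
      exact hcne1 (mul_right_cancel (b := b * b) (hcy'.trans (one_mul _).symm))
    · -- y' = (false,false,q): c * c = b * b ⇒ c = b
      have : y' = (false, false, q) := Prod.ext h1 (Prod.ext hy'2 hd)
      rw [this] at hcy'
      exact hcneb (h2 _ _ hcy')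
  · -- `x = (true, true, q)`: then `q = 1`
    have hq : q = 1 := by
      rcases hcover (true, true, 1) ⟨⟨le_rfl, Bool.false_le _⟩, dvd_rfl⟩ ⟨⟨le_rfl, le_rfl⟩, one_dvd q⟩ with h | h
      · simp at h
      · simpa using (congrArg (fun t => t.2.2) h).symm
    subst hq
    -- `b₂ := f (false,true,1)` and its complementary divisor
    obtain ⟨y', hy', hcy'⟩ := hcompl (false, true, 1) ⟨⟨Bool.false_le _, le_rfl⟩, dvd_rfl⟩
    have hy'3 : y'.2.2 = 1 := eq_one_of_dvd_one_of_isSharp hS hy'.2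
    have hne1 : f (false, true, 1) ≠ 1 := fun h => by
      have := f.injective (h.trans h0.symm); simp at this
    have hneb : f (false, true, 1) ≠ b := fun h => by
      have := f.injective (h.trans hb); simp at this
    have hnebb : f (false, true, 1) ≠ b * b := fun h => by
      have := f.injective (h.trans hfx.symm); simp at this
    rcases Bool.eq_false_or_eq_true y'.1 with h1 | h1 <;> rcases Bool.eq_false_or_eq_true y'.2.1 with h2' | h2'
    · -- y' = (true,true,1) = x: b₂ * b² = b² ⇒ b₂ = 1
      have : y' = (true, true, 1) := Prod.ext h1 (Prod.ext h2' hy'3)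
      rw [this, hfx] at hcy'
      exact hne1 (mul_right_cancel (b := b * b) (hcy'.trans (one_mul _).symm))
    · -- y' = (true,false,1): b₂ * b = b * b ⇒ b₂ = b
      have : y' = (true, false, 1) := Prod.ext h1 (Prod.ext h2' hy'3)
      rw [this, ← hb] at hcy'
      exact hneb (mul_right_cancel hcy')
    · -- y' = (false,true,1): b₂² = b² ⇒ b₂ = b
      have : y' = (false, true, 1) := Prod.ext h1 (Prod.ext h2' hy'3)
      rw [this] at hcy'
      exact hneb (h2 _ _ hcy')
    · -- y' = ⊥: b₂ = b²
      have : y' = (false, false, 1) := Prod.ext h1 (Prod.ext h2' hy'3)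
      rw [this, h0, mul_one] at hcy'
      exact hnebb hcy'

/-- **`Order(M)` has no factor `{0 < 1}`**: for a sharp, integral commutative monoid `M` without `2`-torsion there is
no bijection `g : Bool × M ≃ M` with `g x ∣ g y ↔ x ≤ y` for the product order — iterating such a `g` once would give
the `Bool × Bool × M` version. [cite: MochizukiFrdI2008, §0 p.12] -/
theorem not_dvd_iso_bool_prod (hS : IsSharp M) [IsCancelMul M] (h2 : ∀ a b : M, a * a = b * b → a = b)
    (g : Bool × M ≃ M) (hg : ∀ x y : Bool × M, g x ∣ g y ↔ (x.1 ≤ y.1 ∧ x.2 ∣ y.2)) : False := by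
  -- `f (ε₁, ε₂, m) := g (ε₁, g (ε₂, m))`
  let e : Bool × Bool × M ≃ Bool × M := (Equiv.refl Bool).prodCongr g
  refine not_dvd_iso_bool_bool_prod hS h2 (e.trans g) fun x y => ?_
  show g (x.1, g x.2) ∣ g (y.1, g y.2) ↔ _
  rw [hg, hg]
  exact ⟨fun ⟨h₁, h₂, h₃⟩ => ⟨⟨h₁, h₂⟩, h₃⟩, fun ⟨⟨h₁, h₂⟩, h₃⟩ => ⟨h₁, h₂, h₃⟩⟩

/-! ### v2 (abc-iut-f-128 gen 16, append-only): the `2`-torsion hypothesis is superfluous; the regular-`η` form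

The two theorems above carry the hypothesis `a·a = b·b ⇒ a = b`.  It can be dropped: all that is needed is that the
image `b := f (true, 1)` of the extra Boolean atom be a REGULAR (cancellable) element.  For integral `M` every element
is regular; for a general sharp `M` this is exactly the form in which the obstruction is met by the census of F-2809
(memo #11 §2: an isomorphism of CATEGORIES between the translation category of `M` and `{0 < 1} ×` itself forces the
image of the Boolean atom to be cancellable, because the atom has exactly one arrow to each object above it) — and it
is sharp: the non-integral monoid `⟨ℓ, x_k | x_k·x_k = x_k·ℓ⟩` of `DivisibilityOrderBooleanFactor.lean` (★ p563118)
HAS such an order-isomorphism, with `b = x₀` NOT regular.  ARGUMENT: the divisors of `b` are `1, b`; write `b·b =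
f (true, a₀)`; every divisor `Z` of `a₀` gives `f (true, Z)` between `b` and `b·b`, hence (`b` regular) equal to `b` or
`b·b`, so `a₀` is an atom; put `c := f (false, a₀) ∉ {1, b}`; the same reasoning on `b·c = f (true, a₁)` shows that the
divisors of `a₁` are `1, a₁`; but `c ∣ b·c` gives `a₀ ∣ a₁`, so `a₁ = a₀`, `b·c = b·b`, `c = b` — contradiction. -/

/-- In a sharp monoid, the divisors of the image of the Boolean atom under an order-embedding `f : Bool × M ≃ M` are
`1` and that image. [cite: MochizukiFrdI2008, §0 p.12] -/
private theorem eq_one_or_eq_of_dvd_atom (hS : IsSharp M) (f : Bool × M ≃ M)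
    (hf : ∀ x y : Bool × M, f x ∣ f y ↔ (x.1 ≤ y.1 ∧ x.2 ∣ y.2)) {u : M} (hu : u ∣ f (true, 1)) :
    u = f (false, 1) ∨ u = f (true, 1) := by
  have hx := (hf (f.symm u) (true, 1)).1 (by rw [f.apply_symm_apply]; exact hu)
  have h2 : (f.symm u).2 = 1 := eq_one_of_dvd_one_of_isSharp hS hx.2
  rcases hb : (f.symm u).1 with _ | _
  · left
    rw [← f.apply_symm_apply u]
    exact congrArg f (Prod.ext hb h2)
  · right
    rw [← f.apply_symm_apply u]
    exact congrArg f (Prod.ext hb h2)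

/-- **No Boolean factor for a REGULAR Boolean atom** (sharp `M`, no integrality, no `2`-torsion hypothesis): there is
no bijection `f : Bool × M ≃ M` translating the product order into divisibility for which `f (true, 1)` is a
left-regular (cancellable) element of `M`. [cite: MochizukiFrdI2008, §0 p.12] -/
theorem not_dvd_iso_bool_prod_of_isLeftRegular (hS : IsSharp M) (f : Bool × M ≃ M)
    (hf : ∀ x y : Bool × M, f x ∣ f y ↔ (x.1 ≤ y.1 ∧ x.2 ∣ y.2)) (hreg : IsLeftRegular (f (true, 1))) : False := by
  -- the bottom goes to `1`
  have h0 : f (false, 1) = 1 :=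
    eq_one_of_dvd_one_of_isSharp hS (by
      have := (hf (false, 1) (f.symm 1)).2 ⟨Bool.false_le _, one_dvd _⟩
      rwa [f.apply_symm_apply] at this)
  set b : M := f (true, 1) with hb
  -- KEY STEP (used twice): if `b · v = f (true, a)` and every divisor of `v` is `1` or `v`, then every divisor of `a`
  -- is `1` or `a`
  have key : ∀ (v a : M), b * v = f (true, a) → (∀ u : M, u ∣ v → u = 1 ∨ u = v) →
      ∀ Z : M, Z ∣ a → Z = 1 ∨ Z = a := by
    intro v a hva hv Z hZ
    -- `w := f (true, Z)` lies between `b` and `b·v`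
    have hbw : b ∣ f (true, Z) := (hf (true, 1) (true, Z)).2 ⟨le_rfl, one_dvd Z⟩
    have hwb : f (true, Z) ∣ b * v := by rw [hva]; exact (hf (true, Z) (true, a)).2 ⟨le_rfl, hZ⟩
    obtain ⟨u, hu⟩ := hbw
    obtain ⟨u', hu'⟩ := hwb
    -- `b · v = b · u · u'`, so `v = u · u'` (regularity) and `u ∣ v`
    have hv' : v = u * u' := hreg (show b * v = b * (u * u') by rw [hu', hu, mul_assoc])
    rcases hv u ⟨u', hv'⟩ with rfl | rfl
    · -- `w = b`, so `Z = 1`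
      left
      have : (true, Z) = (true, (1 : M)) := f.injective (by rw [hu, mul_one])
      exact congrArg Prod.snd this
    · -- `w = b · v = f (true, a)`, so `Z = a`
      right
      have : (true, Z) = (true, a) := f.injective (by rw [hu, hva])
      exact congrArg Prod.snd this
  -- `b·b = f (true, a₀)` with `a₀` an atom
  obtain ⟨⟨x1, a₀⟩, hfx⟩ : ∃ x : Bool × M, f x = b * b := ⟨f.symm (b * b), f.apply_symm_apply _⟩
  have hx1 : x1 = true := by
    have := ((hf (true, 1) (x1, a₀)).1 (by rw [hfx]; exact Dvd.intro b rfl)).1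
    revert this; cases x1 <;> simp
  subst hx1
  have hdivb : ∀ u : M, u ∣ b → u = 1 ∨ u = b := fun u hu => by
    rcases eq_one_or_eq_of_dvd_atom hS f hf hu with h | h
    · exact Or.inl (h.trans h0)
    · exact Or.inr h
  have ha₀ : ∀ Z : M, Z ∣ a₀ → Z = 1 ∨ Z = a₀ := key b a₀ hfx.symm hdivb
  have ha₀1 : a₀ ≠ 1 := by
    intro h
    rw [h] at hfx
    rw [← hb] at hfx
    have h1 : b * b = b * 1 := by rw [mul_one]; exact hfx.symm
    have h2 : b = 1 := hreg h1
    have h3 : f (true, 1) = f (false, 1) := by rw [← hb, h2, h0]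
    exact absurd (f.injective h3) (by simp)
  -- `c := f (false, a₀)`: neither `1` nor `b`; its divisors are `1` and `c`
  set c : M := f (false, a₀) with hc
  have hdivc : ∀ u : M, u ∣ c → u = 1 ∨ u = c := by
    intro u hu
    have hx := (hf (f.symm u) (false, a₀)).1 (by rw [f.apply_symm_apply]; exact hu)
    have h1 : (f.symm u).1 = false := by
      have := hx.1
      revert this; cases (f.symm u).1 <;> simp
    rcases ha₀ _ hx.2 with h2 | h2
    · left
      rw [← f.apply_symm_apply u, ← h0]
      exact congrArg f (Prod.ext h1 h2)
    · right
      rw [← f.apply_symm_apply u]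
      exact congrArg f (Prod.ext h1 h2)
  -- `b·c = f (true, a₁)` with `a₁` an atom
  obtain ⟨⟨y1, a₁⟩, hfy⟩ : ∃ y : Bool × M, f y = b * c := ⟨f.symm (b * c), f.apply_symm_apply _⟩
  have hy1 : y1 = true := by
    have := ((hf (true, 1) (y1, a₁)).1 (by rw [hfy]; exact Dvd.intro c rfl)).1
    revert this; cases y1 <;> simp
  subst hy1
  have ha₁ : ∀ Z : M, Z ∣ a₁ → Z = 1 ∨ Z = a₁ := key c a₁ hfy.symm hdivc
  -- `c ∣ b·c` gives `a₀ ∣ a₁`, hence `a₀ = a₁`, `b·c = b·b`, `c = b`: contradiction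
  have ha₀a₁ : a₀ ∣ a₁ := ((hf (false, a₀) (true, a₁)).1 (by rw [hfy]; exact Dvd.intro_left b rfl)).2
  rcases ha₁ a₀ ha₀a₁ with h | h
  · exact ha₀1 h
  · have hbc : b * c = b * b := by rw [← hfy, ← hfx, h]
    have hcb : c = b := hreg hbc
    have : (false, a₀) = (true, (1 : M)) := f.injective hcb
    simp at this

/-- **`Order(M)` has no Boolean factor for ANY sharp integral monoid** — the `2`-torsion hypothesis of
`not_dvd_iso_bool_prod` removed. [cite: MochizukiFrdI2008, §0 p.12] -/
theorem not_dvd_iso_bool_prod' (hS : IsSharp M) [IsCancelMul M] (f : Bool × M ≃ M)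
    (hf : ∀ x y : Bool × M, f x ∣ f y ↔ (x.1 ≤ y.1 ∧ x.2 ∣ y.2)) : False :=
  not_dvd_iso_bool_prod_of_isLeftRegular hS f hf fun _ _ h => mul_left_cancel h

/-! ### v3 (abc-iut-f-128 gen 16, append-only): no factor `{0 < 1} × Q` for ANY poset `Q` with a least element

The argument of v2 never uses that the second factor is `Order(M)` itself: for a sharp monoid `M` and ANY partially
ordered set `Q` with a least element there is no bijection `f : Bool × Q ≃ M` translating the product order into
divisibility with `f (true, ⊥)` regular.  (Census of F-2809, memo #11 appendix, Exclusion 1: the glued translation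
category of a walking-arrow model can be order-isomorphic to `Order(Φ(T))` only if it is NOT of product form, i.e. only
if the pull-back `g^*` is ramified at an atom.) -/

/-- **`Order(M)` has no factor `{0 < 1} × Q`, `Q` any poset with a least element**, for a sharp monoid `M` and a
regular Boolean-atom image: there is no bijection `f : Bool × Q ≃ M` with `f x ∣ f y ↔ x ≤ y` (product order) such that
`f (true, ⊥)` is left-regular.  Same proof as `not_dvd_iso_bool_prod_of_isLeftRegular`. [cite: MochizukiFrdI2008, §0 p.12] -/
theorem not_dvd_iso_bool_prod_poset_of_isLeftRegular {Q : Type*} [PartialOrder Q] [OrderBot Q] (hS : IsSharp M)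
    (f : Bool × Q ≃ M) (hf : ∀ x y : Bool × Q, f x ∣ f y ↔ (x.1 ≤ y.1 ∧ x.2 ≤ y.2))
    (hreg : IsLeftRegular (f (true, ⊥))) : False := by
  -- the bottom goes to `1`
  have h0 : f (false, ⊥) = 1 :=
    eq_one_of_dvd_one_of_isSharp hS (by
      have := (hf (false, ⊥) (f.symm 1)).2 ⟨Bool.false_le _, bot_le⟩
      rwa [f.apply_symm_apply] at this)
  set b : M := f (true, ⊥) with hb
  -- KEY STEP: if `b · v = f (true, a)` and every divisor of `v` is `1` or `v`, then every `q ≤ a` is `⊥` or `a`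
  have key : ∀ (v : M) (a : Q), b * v = f (true, a) → (∀ u : M, u ∣ v → u = 1 ∨ u = v) →
      ∀ q : Q, q ≤ a → q = ⊥ ∨ q = a := by
    intro v a hva hv q hq
    have hbw : b ∣ f (true, q) := (hf (true, ⊥) (true, q)).2 ⟨le_rfl, bot_le⟩
    have hwb : f (true, q) ∣ b * v := by rw [hva]; exact (hf (true, q) (true, a)).2 ⟨le_rfl, hq⟩
    obtain ⟨u, hu⟩ := hbw
    obtain ⟨u', hu'⟩ := hwb
    have hv' : v = u * u' := hreg (show b * v = b * (u * u') by rw [hu', hu, mul_assoc])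
    rcases hv u ⟨u', hv'⟩ with rfl | rfl
    · left
      have : (true, q) = (true, (⊥ : Q)) := f.injective (by rw [hu, mul_one])
      exact congrArg Prod.snd this
    · right
      have : (true, q) = (true, a) := f.injective (by rw [hu, hva])
      exact congrArg Prod.snd this
  -- divisors of `b` are `1` and `b`
  have hdivb : ∀ u : M, u ∣ b → u = 1 ∨ u = b := by
    intro u hu
    have hx := (hf (f.symm u) (true, ⊥)).1 (by rw [f.apply_symm_apply]; exact hu)
    have h2 : (f.symm u).2 = ⊥ := le_bot_iff.1 hx.2
    rcases h1 : (f.symm u).1 with _ | _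
    · left
      rw [← f.apply_symm_apply u, ← h0]
      exact congrArg f (Prod.ext h1 h2)
    · right
      rw [← f.apply_symm_apply u]
      exact congrArg f (Prod.ext h1 h2)
  -- `b·b = f (true, a₀)` with `a₀` an atom of `Q`
  obtain ⟨⟨x1, a₀⟩, hfx⟩ : ∃ x : Bool × Q, f x = b * b := ⟨f.symm (b * b), f.apply_symm_apply _⟩
  have hx1 : x1 = true := by
    have := ((hf (true, ⊥) (x1, a₀)).1 (by rw [hfx]; exact Dvd.intro b rfl)).1
    revert this; cases x1 <;> simp
  subst hx1
  have ha₀ : ∀ q : Q, q ≤ a₀ → q = ⊥ ∨ q = a₀ := key b a₀ hfx.symm hdivb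
  have ha₀1 : a₀ ≠ ⊥ := by
    intro h
    rw [h] at hfx
    rw [← hb] at hfx
    have h1 : b * b = b * 1 := by rw [mul_one]; exact hfx.symm
    have h2 : b = 1 := hreg h1
    have h3 : f (true, ⊥) = f (false, ⊥) := by rw [← hb, h2, h0]
    exact absurd (f.injective h3) (by simp)
  -- `c := f (false, a₀)`: its divisors are `1` and `c`
  set c : M := f (false, a₀) with hc
  have hdivc : ∀ u : M, u ∣ c → u = 1 ∨ u = c := by
    intro u hu
    have hx := (hf (f.symm u) (false, a₀)).1 (by rw [f.apply_symm_apply]; exact hu)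
    have h1 : (f.symm u).1 = false := by
      have := hx.1
      revert this; cases (f.symm u).1 <;> simp
    rcases ha₀ _ hx.2 with h2 | h2
    · left
      rw [← f.apply_symm_apply u, ← h0]
      exact congrArg f (Prod.ext h1 h2)
    · right
      rw [← f.apply_symm_apply u]
      exact congrArg f (Prod.ext h1 h2)
  -- `b·c = f (true, a₁)` with `a₁` an atom of `Q`
  obtain ⟨⟨y1, a₁⟩, hfy⟩ : ∃ y : Bool × Q, f y = b * c := ⟨f.symm (b * c), f.apply_symm_apply _⟩
  have hy1 : y1 = true := by
    have := ((hf (true, ⊥) (y1, a₁)).1 (by rw [hfy]; exact Dvd.intro c rfl)).1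
    revert this; cases y1 <;> simp
  subst hy1
  have ha₁ : ∀ q : Q, q ≤ a₁ → q = ⊥ ∨ q = a₁ := key c a₁ hfy.symm hdivc
  -- `c ∣ b·c` gives `a₀ ≤ a₁`, so `a₀ = a₁`, `b·c = b·b`, `c = b`: contradiction
  have ha₀a₁ : a₀ ≤ a₁ := ((hf (false, a₀) (true, a₁)).1 (by rw [hfy]; exact Dvd.intro_left b rfl)).2
  rcases ha₁ a₀ ha₀a₁ with h | h
  · exact ha₀1 h
  · have hbc : b * c = b * b := by rw [← hfy, ← hfx, h]
    have hcb : c = b := hreg hbc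
    have : (false, a₀) = (true, (⊥ : Q)) := f.injective hcb
    simp at this

/-- **`Order(M)` has no factor `{0 < 1} × Q` for ANY sharp integral `M` and any poset `Q` with a least element.**
[cite: MochizukiFrdI2008, §0 p.12] -/
theorem not_dvd_iso_bool_prod_poset (hS : IsSharp M) [IsCancelMul M] {Q : Type*} [PartialOrder Q] [OrderBot Q]
    (f : Bool × Q ≃ M) (hf : ∀ x y : Bool × Q, f x ∣ f y ↔ (x.1 ≤ y.1 ∧ x.2 ≤ y.2)) : False :=
  not_dvd_iso_bool_prod_poset_of_isLeftRegular hS f hf fun _ _ h => mul_left_cancel h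

end Literature.AlgebraicGeometry.Frobenioids
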